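import Summits.QuantumFields.YangMills.Theorems.BalabanUVNodesK3V7Defs
import Summits.QuantumFields.YangMills.Theorems.BalabanUVNodesN21GappedPairRoadK3V6KnitZeta

/-!
# N21 (NE7c) · THE LANE's STUB-2 SHARE AT THE v7 PIN: skeleton v7's `stub_expansion13HV` BODY ∕ TEXT FROM DISPLAYED ROWS, the N21 and N27x conjuncts being THEOREMS inside
# (pair gap pin `K3V7Defs.PinnedAtLiveGap2` + `DialRows`; (H-ζ) discharged by the provisos' row `zetaMeas`)

R134 seat `pub-ymgap-dag-n21-d` (g17, lane owner N21), strategy s2; key K3⁸ `SpineGivenEndpointR13SepCoPHV` = stmt-QuantumFields-27366, `--kind proof --supports 27366 --as helper`;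
COUNT-NEUTRAL.  Theorems only (0 `def`, 0 `sorry`, no `instance`, no `notation`).  v7 = director-ym №238 + plan g89 [YMPLAN-G89-K3V7]: v6 with the stub-2 pin
`PinnedAtLive jc sh cr` ↦ `PinnedAtLiveGap2 jc ρ ρ′ n₁ n₂ cr ∧ DialRows ρ ρ′ n₁ n₂`; this file is the lane's probe #46 (d5c9121e3a756de2) §4 re-keyed to the tree mirror `…K3V7Defs` with the
(H-ζ) binder gone (ζ1 p658766).

WHAT IS PROVED ([bookkeeping] BY NAME over ζ1 `exists_gap2Pinned_faces(_cutZero)_zeta` and `K3V7Defs`; NO estimate):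
* ★★★ `stub2BodyV7_of_rows_zeta` — at one `(β, rr)`: the dial rows; N20 = a WITNESS `W` of `RelWeightBound` at the PAIR-GAPPED carriers `gapWeight2A∕B₁₃` with persistence class
  `badClass₁₃ θ 0 g₀ (jc …)` (literally equivalent to N20's v6 text at the record carriers for every policy `jc K < K ∨ jc K = 0`, V5b p635796); N19′ = under (B) → END → `ForSmallCouplings` →
  `PHolderD4 β`, «∃ summable δ, `NE7.Core` between the two runs' DOUBLY-GAPPED cores off the bad class» (NE7 proper; NOT PRINTED for d = 4); node U5's Target off the live line ⟹ THE v7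
  STUB-2 BODY `∃ jc ρ ρ′ n₁ n₂ cr, PinnedAtLiveGap2 … ∧ DialRows … ∧ KeyedRelWeight cr ∧ KeyedShellWeight cr ∧ KeyedExtractionV cr ∧ KeyedCoreEdgeHolderD4V β cr rr` — N21's
  `KeyedShellWeight` and N27x's `KeyedExtractionV` conjuncts are the lane's ∕ dag-n21-w2's ∕ dag-n21-w7's THEOREMS inside (ζ1 ∕ V8 ∕ p645435);
* ★★ `stub2BodyV7_of_rows_cutZero_zeta` — the same at the ZERO cut `jc ≡ 0`: NO N20 row (the persistence class is empty; dag-n20-w2 p635103), N19′ asked on EVERY keyed class;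
* ★★★ `stub2TextV7_of_rows_zeta` — THE REGISTERED v7 STUB-2 TEXT (`…K3Skeleton13SepCoPHV7.stub_expansion13HV`'s statement, verbatim) from rows keyed on stub 1's binders: for every
  `β ∈ ]2∕3, 1[` and every guarded N16-pinned rate reading carrying K4 at the slot, SOME `jc` and dials with their rows + the N20 witness + the N19′ sandwich (at `rr := rrOfRecord 𝔯 ksel`) +
  Target — the shape in which the N19′ ∕ N20 ∕ U5 seats file their shares;
* ★★ `spineGivenEndpointR13SepCoPHV_of_stub1Text_of_rows_zeta` — stub 1's text + those rows ⟹ K3⁸ BY NAME (`K3V7Defs.spineGivenEndpointR13SepCoPHV_of_stubTextsV7`).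

HONEST FRAMING (binding).  Compositions BY NAME; NO estimate of Bałaban's; NE7c at print's FIXED thresholds NOT PRINTED ∕ NOT proved (at the v7 pin none is read: the shells are
SELECTED, [Balaban1989LargeFieldI] p. 181); K4 ∕ N20 ∕ N19′ ∕ Target are HYPOTHESES (N19′'s sandwich NOT PRINTED for `d = 4`; inhabited for no family, K0⁷ OPEN); this file does NOT
close `stub_expansion13HV` (its N19′ ∕ N20 ∕ Target rows are other lanes' open content) and does NOT claim K3⁸; N21 NOT discharged by it (the chair books, never the lane); counts UNMOVED
(typed 28∕28 · discharged 6∕28, display 6∕27); never a count claim.  Standard axioms only.  One finite four-torus programme at fixed `ε` — NOT ℝ⁴, NOT OS, NOT a mass gap, NOT Clay.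
-/

set_option autoImplicit false

noncomputable section

open scoped BigOperators

namespace Summit.QuantumFields.YangMills.Theorems.N21GappedRoadK3V7Knit

open Literature.MathematicalPhysics.QuantumFieldTheory.Balaban1983to89
open Literature.MathematicalPhysics.QuantumFieldTheory.Balaban1983to89.T4Continuum
open Literature.MathematicalPhysics.QuantumFieldTheory.Balaban1983to89.Node00
open T4WeightBudget (RelWeightBound)
open T4ContinuumYM4Torus (ForSmallCouplings)
open Summit.QuantumFields.BalabanUV.T4Continuum.Spine
open YMDAG.UVSplit (RateReading₁₃CoPH classSet₁₃ badClass₁₃)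
open Summit.QuantumFields.YangMills.Theorems.K3V5Defs (SpineReading RateReadingFn RunSel LetterReading CutReading rrOfRecord PHolderD4 GuardedReadingN16 KeyedRelWeight KeyedShellWeight
  LiveSel)
open Summit.QuantumFields.YangMills.Theorems.K3V6Defs (KeyedRatesHolderD4V KeyedCoreEdgeHolderD4V KeyedExtractionV)
open Summit.QuantumFields.YangMills.Theorems.K3V7Defs (PinnedAtLiveGap2 DialRows spineGivenEndpointR13SepCoPHV_of_stubTextsV7)
open Summit.QuantumFields.YangMills.Theorems.N21ShellSplitOfRecord13CoPH (WidthLetter₁₃CoPH DepthLetter₁₃CoPH)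
open Summit.QuantumFields.YangMills.Theorems.N21GappedTopPair13CoPH (crGap2₁₃V gapWeight2A₁₃ gapWeight2B₁₃ gapCore2A₁₃ gapCore2B₁₃)
open Summit.QuantumFields.YangMills.Theorems.N21GappedRoadK3V6Knit (exists_gap2Pinned_faces_zeta exists_gap2Pinned_faces_cutZero_zeta)

section Rows

variable (jc : CutReading) (ρ ρ' : WidthLetter₁₃CoPH 2) (n₁ n₂ : DepthLetter₁₃CoPH 2)

/-- ★★★ **THE v7 STUB-2 BODY AT `(β, rr)` FROM DISPLAYED ROWS** — binder by binder: the dial rows; N20 = a WITNESS `W` of `RelWeightBound` at the PAIR-GAPPED carriers with persistence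
class `badClass₁₃ θ 0 g₀ (jc …)`; N19′ = for every slot `v`, under (B) → END → `ForSmallCouplings` and `PHolderD4 β`, «∃ summable `δ`, `NE7.Core` between the two runs' DOUBLY-GAPPED cores
off the bad class» (NOT PRINTED for d = 4); node U5's Target off the live line.  THEN the v7 stub-2 body holds at `(β, rr)`, its N21 `KeyedShellWeight` and N27x `KeyedExtractionV` conjuncts
being THEOREMS (ζ1 `exists_gap2Pinned_faces_zeta`; (H-ζ) = `hP.zetaMeas`).  CONDITIONAL; nothing inhabited; not the registered stub (whose rows belong to the N19′ ∕ N20 ∕ U5 lanes). [bookkeeping] -/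
theorem stub2BodyV7_of_rows_zeta (β : ℝ) (rr : RateReadingFn)
    (hdials : DialRows ρ ρ' n₁ n₂)
    (h20 : ∀ (F : T4Family) (θ : Stage13HParams F 2) (hP : θ.Provisos₁₃CoPH F 2), ((θ.ZhUnity F 2 ∧ θ.SlotsNondegenerate₁₃ F 2) ∧ LiveSel F θ) → θ.Admissible F 2 →
      ∀ (g₀ : ℕ → ℝ) (os : List (ULoop F)),
        ∃ W : ℕ → ℝ, RelWeightBound 1 (classSet₁₃ θ 0 g₀)
          (gapWeight2A₁₃ θ hP 0 g₀ os (ρ F θ hP g₀ os) (ρ' F θ hP g₀ os) (n₁ F θ hP g₀ os) (n₂ F θ hP g₀ os))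
          (gapWeight2B₁₃ θ hP 0 g₀ os (ρ F θ hP g₀ os) (ρ' F θ hP g₀ os) (n₁ F θ hP g₀ os) (n₂ F θ hP g₀ os)) (badClass₁₃ θ 0 g₀ (jc F θ hP g₀ os)) W)
    (h19 : ∀ (F : T4Family) (θ : Stage13HParams F 2) (h : θ.Provisos₁₃SepCoPH F 2) (v : Revision₁₃ F 2 θ h),
      ((θ.ZhUnity F 2 ∧ θ.SlotsNondegenerate₁₃ F 2) ∧ LiveSel F θ) → θ.Admissible F 2 →
      B16.EndStatementBPrinted (datumOfRecord₁₃SepCoPHV F 2 θ h v).C → DagBinding.EndpointExistence (datumOfRecord₁₃SepCoPHV F 2 θ h v).C.toB12 →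
        ForSmallCouplings (datumOfRecord₁₃SepCoPHV F 2 θ h v) fun g₀ => ∀ os : List (ULoop F),
          PHolderD4 β (datumOfRecord₁₃SepCoPHV F 2 θ h v) (rr F θ h.toCore g₀ os) →
            letI : DecidableEq (Σ K, SiteSeqKey F (0 + K)) := Classical.decEq _
            ∃ δ : ℕ → ℝ, NE7.Core 1 (F.side ^ 4) (classSet₁₃ θ 0 g₀) (badClass₁₃ θ 0 g₀ (jc F θ h.toCore g₀ os))
              (gapCore2A₁₃ θ h.toCore 0 g₀ os (ρ F θ h.toCore g₀ os) (ρ' F θ h.toCore g₀ os) (n₁ F θ h.toCore g₀ os) (n₂ F θ h.toCore g₀ os))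
              (gapCore2B₁₃ θ h.toCore 0 g₀ os (ρ F θ h.toCore g₀ os) (ρ' F θ h.toCore g₀ os) (n₁ F θ h.toCore g₀ os) (n₂ F θ h.toCore g₀ os)) δ ∧ Summable δ)
    (htarget : ∀ (F : T4Family) (θ : Stage13HParams F 2) (hP : θ.Provisos₁₃CoPH F 2), ((θ.ZhUnity F 2 ∧ θ.SlotsNondegenerate₁₃ F 2) ∧ ¬ LiveSel F θ) → θ.Admissible F 2 →
      ∀ (g₀ : ℕ → ℝ) (os : List (ULoop F)), PHolderD4 β (datumOfRecord₁₃CoPH F 2 θ hP) (rr F θ hP g₀ os) →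
        ∃ δ : ℕ → ℝ, NE7.Target ((F.side : ℝ) ^ 4) 1 δ (fun K => T4GenFunBounds.schemeZ ((datumOfRecord₁₃CoPH F 2 θ hP).scheme g₀) os (0 + K))) :
    ∃ (jc : CutReading) (ρ ρ' : WidthLetter₁₃CoPH 2) (n₁ n₂ : DepthLetter₁₃CoPH 2) (cr : SpineReading), PinnedAtLiveGap2 jc ρ ρ' n₁ n₂ cr ∧ DialRows ρ ρ' n₁ n₂ ∧
      KeyedRelWeight cr ∧ KeyedShellWeight cr ∧ KeyedExtractionV cr ∧ KeyedCoreEdgeHolderD4V β cr rr := by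
  obtain ⟨cr, hon, -, h20', h21', hx', h19'⟩ :=
    exists_gap2Pinned_faces_zeta (ρ := ρ) (ρ' := ρ') (n₁ := n₁) (n₂ := n₂) β rr jc hdials.1 hdials.2 h20 h19 htarget
  exact ⟨jc, ρ, ρ', n₁, n₂, cr, hon, hdials, h20', h21', hx', h19'⟩

/-- ★★ **THE v7 STUB-2 BODY AT THE ZERO CUT — NO N20 ROW** (ζ1 `exists_gap2Pinned_faces_cutZero_zeta`): at `jc ≡ 0` the persistence class is EMPTY, so N20's witness binder is discharged
vacuously (dag-n20-w2 p635103; NOT node N20's estimate) and N19′ is asked on EVERY keyed class between the doubly-gapped cores; the dial rows and node U5's Target as above.  The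
fewest-binder form of what v7's stub 2 owes at one `(β, rr)`. [bookkeeping] -/
theorem stub2BodyV7_of_rows_cutZero_zeta (β : ℝ) (rr : RateReadingFn)
    (hdials : DialRows ρ ρ' n₁ n₂)
    (h19 : ∀ (F : T4Family) (θ : Stage13HParams F 2) (h : θ.Provisos₁₃SepCoPH F 2) (v : Revision₁₃ F 2 θ h),
      ((θ.ZhUnity F 2 ∧ θ.SlotsNondegenerate₁₃ F 2) ∧ LiveSel F θ) → θ.Admissible F 2 →
      B16.EndStatementBPrinted (datumOfRecord₁₃SepCoPHV F 2 θ h v).C → DagBinding.EndpointExistence (datumOfRecord₁₃SepCoPHV F 2 θ h v).C.toB12 →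
        ForSmallCouplings (datumOfRecord₁₃SepCoPHV F 2 θ h v) fun g₀ => ∀ os : List (ULoop F),
          PHolderD4 β (datumOfRecord₁₃SepCoPHV F 2 θ h v) (rr F θ h.toCore g₀ os) →
            ∃ δ : ℕ → ℝ, (∀ K : ℕ, ∃ c : ℝ, ∀ t : ℝ, |t| ≤ 1 → ∀ x ∈ classSet₁₃ θ 0 g₀ K,
              Real.exp (c - F.side ^ 4 * δ K) *
                  gapCore2A₁₃ θ h.toCore 0 g₀ os (ρ F θ h.toCore g₀ os) (ρ' F θ h.toCore g₀ os) (n₁ F θ h.toCore g₀ os) (n₂ F θ h.toCore g₀ os) K t x ≤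
                gapCore2B₁₃ θ h.toCore 0 g₀ os (ρ F θ h.toCore g₀ os) (ρ' F θ h.toCore g₀ os) (n₁ F θ h.toCore g₀ os) (n₂ F θ h.toCore g₀ os) K t x ∧
              gapCore2B₁₃ θ h.toCore 0 g₀ os (ρ F θ h.toCore g₀ os) (ρ' F θ h.toCore g₀ os) (n₁ F θ h.toCore g₀ os) (n₂ F θ h.toCore g₀ os) K t x ≤
                Real.exp (c + F.side ^ 4 * δ K) *
                  gapCore2A₁₃ θ h.toCore 0 g₀ os (ρ F θ h.toCore g₀ os) (ρ' F θ h.toCore g₀ os) (n₁ F θ h.toCore g₀ os) (n₂ F θ h.toCore g₀ os) K t x) ∧ Summable δ)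
    (htarget : ∀ (F : T4Family) (θ : Stage13HParams F 2) (hP : θ.Provisos₁₃CoPH F 2), ((θ.ZhUnity F 2 ∧ θ.SlotsNondegenerate₁₃ F 2) ∧ ¬ LiveSel F θ) → θ.Admissible F 2 →
      ∀ (g₀ : ℕ → ℝ) (os : List (ULoop F)), PHolderD4 β (datumOfRecord₁₃CoPH F 2 θ hP) (rr F θ hP g₀ os) →
        ∃ δ : ℕ → ℝ, NE7.Target ((F.side : ℝ) ^ 4) 1 δ (fun K => T4GenFunBounds.schemeZ ((datumOfRecord₁₃CoPH F 2 θ hP).scheme g₀) os (0 + K))) :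
    ∃ (jc : CutReading) (ρ ρ' : WidthLetter₁₃CoPH 2) (n₁ n₂ : DepthLetter₁₃CoPH 2) (cr : SpineReading), PinnedAtLiveGap2 jc ρ ρ' n₁ n₂ cr ∧ DialRows ρ ρ' n₁ n₂ ∧
      KeyedRelWeight cr ∧ KeyedShellWeight cr ∧ KeyedExtractionV cr ∧ KeyedCoreEdgeHolderD4V β cr rr := by
  obtain ⟨cr, hon, -, h20', h21', hx', h19'⟩ :=
    exists_gap2Pinned_faces_cutZero_zeta (ρ := ρ) (ρ' := ρ') (n₁ := n₁) (n₂ := n₂) β rr hdials.1 hdials.2 h19 htarget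
  exact ⟨fun _ _ _ _ _ _ => 0, ρ, ρ', n₁, n₂, cr, hon, hdials, h20', h21', hx', h19'⟩

end Rows

/-- ★★★ **THE REGISTERED v7 STUB-2 TEXT FROM ROWS KEYED ON STUB 1's BINDERS** (the statement of `…K3Skeleton13SepCoPHV7.stub_expansion13HV`, verbatim): if, for every `β ∈ ]2∕3, 1[` and
every guarded N16-pinned rate reading carrying K4 at the slot, the N20 witness, the N19′ sandwich (at `rr := rrOfRecord 𝔯 ksel`) and node U5's Target are supplied at SOME cut policy and
SOME dials with their rows — the shape in which the N19′ ∕ N20 ∕ U5 seats file their stub-2 shares — then the v7 stub-2 text holds.  CONDITIONAL; does not close the stub. [bookkeeping] -/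
theorem stub2TextV7_of_rows_zeta
    (hrows : ∀ β : ℝ, 2 / 3 < β → β < 1 →
      ∀ (𝔯 : RateReading₁₃CoPH 2) (ksel : RunSel) (ℓ : LetterReading) (ℓ₃ : T4Family → Node00.NE3Letters₁₁) (g B : T4Family → ℝ),
      GuardedReadingN16 𝔯 ksel ℓ ℓ₃ g B → KeyedRatesHolderD4V β (rrOfRecord 𝔯 ksel) →
      ∃ (jc : CutReading) (ρ ρ' : WidthLetter₁₃CoPH 2) (n₁ n₂ : DepthLetter₁₃CoPH 2), DialRows ρ ρ' n₁ n₂ ∧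
      (∀ (F : T4Family) (θ : Stage13HParams F 2) (hP : θ.Provisos₁₃CoPH F 2), ((θ.ZhUnity F 2 ∧ θ.SlotsNondegenerate₁₃ F 2) ∧ LiveSel F θ) → θ.Admissible F 2 →
        ∀ (g₀ : ℕ → ℝ) (os : List (ULoop F)),
          ∃ W : ℕ → ℝ, RelWeightBound 1 (classSet₁₃ θ 0 g₀)
            (gapWeight2A₁₃ θ hP 0 g₀ os (ρ F θ hP g₀ os) (ρ' F θ hP g₀ os) (n₁ F θ hP g₀ os) (n₂ F θ hP g₀ os))
            (gapWeight2B₁₃ θ hP 0 g₀ os (ρ F θ hP g₀ os) (ρ' F θ hP g₀ os) (n₁ F θ hP g₀ os) (n₂ F θ hP g₀ os)) (badClass₁₃ θ 0 g₀ (jc F θ hP g₀ os)) W) ∧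
      (∀ (F : T4Family) (θ : Stage13HParams F 2) (h : θ.Provisos₁₃SepCoPH F 2) (v : Revision₁₃ F 2 θ h),
        ((θ.ZhUnity F 2 ∧ θ.SlotsNondegenerate₁₃ F 2) ∧ LiveSel F θ) → θ.Admissible F 2 →
        B16.EndStatementBPrinted (datumOfRecord₁₃SepCoPHV F 2 θ h v).C → DagBinding.EndpointExistence (datumOfRecord₁₃SepCoPHV F 2 θ h v).C.toB12 →
          ForSmallCouplings (datumOfRecord₁₃SepCoPHV F 2 θ h v) fun g₀ => ∀ os : List (ULoop F),
            PHolderD4 β (datumOfRecord₁₃SepCoPHV F 2 θ h v) (rrOfRecord 𝔯 ksel F θ h.toCore g₀ os) →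
              letI : DecidableEq (Σ K, SiteSeqKey F (0 + K)) := Classical.decEq _
              ∃ δ : ℕ → ℝ, NE7.Core 1 (F.side ^ 4) (classSet₁₃ θ 0 g₀) (badClass₁₃ θ 0 g₀ (jc F θ h.toCore g₀ os))
                (gapCore2A₁₃ θ h.toCore 0 g₀ os (ρ F θ h.toCore g₀ os) (ρ' F θ h.toCore g₀ os) (n₁ F θ h.toCore g₀ os) (n₂ F θ h.toCore g₀ os))
                (gapCore2B₁₃ θ h.toCore 0 g₀ os (ρ F θ h.toCore g₀ os) (ρ' F θ h.toCore g₀ os) (n₁ F θ h.toCore g₀ os) (n₂ F θ h.toCore g₀ os)) δ ∧ Summable δ) ∧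
      (∀ (F : T4Family) (θ : Stage13HParams F 2) (hP : θ.Provisos₁₃CoPH F 2), ((θ.ZhUnity F 2 ∧ θ.SlotsNondegenerate₁₃ F 2) ∧ ¬ LiveSel F θ) → θ.Admissible F 2 →
        ∀ (g₀ : ℕ → ℝ) (os : List (ULoop F)), PHolderD4 β (datumOfRecord₁₃CoPH F 2 θ hP) (rrOfRecord 𝔯 ksel F θ hP g₀ os) →
          ∃ δ : ℕ → ℝ, NE7.Target ((F.side : ℝ) ^ 4) 1 δ (fun K => T4GenFunBounds.schemeZ ((datumOfRecord₁₃CoPH F 2 θ hP).scheme g₀) os (0 + K)))) :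
    ∀ β : ℝ, 2 / 3 < β → β < 1 →
      ∀ (𝔯 : RateReading₁₃CoPH 2) (ksel : RunSel) (ℓ : LetterReading) (ℓ₃ : T4Family → Node00.NE3Letters₁₁) (g B : T4Family → ℝ),
        GuardedReadingN16 𝔯 ksel ℓ ℓ₃ g B → KeyedRatesHolderD4V β (rrOfRecord 𝔯 ksel) →
        ∃ (jc : CutReading) (ρ ρ' : WidthLetter₁₃CoPH 2) (n₁ n₂ : DepthLetter₁₃CoPH 2) (cr : SpineReading), PinnedAtLiveGap2 jc ρ ρ' n₁ n₂ cr ∧ DialRows ρ ρ' n₁ n₂ ∧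
          KeyedRelWeight cr ∧ KeyedShellWeight cr ∧ KeyedExtractionV cr ∧ KeyedCoreEdgeHolderD4V β cr (rrOfRecord 𝔯 ksel) := by
  intro β hβ hβ' 𝔯 ksel ℓ ℓ₃ g B hg hr
  obtain ⟨jc, ρ, ρ', n₁, n₂, hdials, h20, h19, htarget⟩ := hrows β hβ hβ' 𝔯 ksel ℓ ℓ₃ g B hg hr
  exact stub2BodyV7_of_rows_zeta jc ρ ρ' n₁ n₂ β (rrOfRecord 𝔯 ksel) hdials h20 h19 htarget

/-- ★★ **STUB 1's TEXT + THE ROWS ⟹ K3⁸ BY NAME** (`K3V7Defs.spineGivenEndpointR13SepCoPHV_of_stubTextsV7` after `stub2TextV7_of_rows_zeta`).  Every displayed binder a HYPOTHESIS (stub 1 = K4 at the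
slot, XL, open; the rows = N19′ ∕ N20 ∕ U5's open content); CONDITIONAL; K3⁸ NOT claimed. [bookkeeping] -/
theorem spineGivenEndpointR13SepCoPHV_of_stub1Text_of_rows_zeta
    (h₁ : ∃ β : ℝ, 2 / 3 < β ∧ β < 1 ∧
      ∃ (𝔯 : RateReading₁₃CoPH 2) (ksel : RunSel) (ℓ : LetterReading) (ℓ₃ : T4Family → Node00.NE3Letters₁₁) (g B : T4Family → ℝ),
        GuardedReadingN16 𝔯 ksel ℓ ℓ₃ g B ∧ KeyedRatesHolderD4V β (rrOfRecord 𝔯 ksel))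
    (hrows : ∀ β : ℝ, 2 / 3 < β → β < 1 →
      ∀ (𝔯 : RateReading₁₃CoPH 2) (ksel : RunSel) (ℓ : LetterReading) (ℓ₃ : T4Family → Node00.NE3Letters₁₁) (g B : T4Family → ℝ),
      GuardedReadingN16 𝔯 ksel ℓ ℓ₃ g B → KeyedRatesHolderD4V β (rrOfRecord 𝔯 ksel) →
      ∃ (jc : CutReading) (ρ ρ' : WidthLetter₁₃CoPH 2) (n₁ n₂ : DepthLetter₁₃CoPH 2), DialRows ρ ρ' n₁ n₂ ∧
      (∀ (F : T4Family) (θ : Stage13HParams F 2) (hP : θ.Provisos₁₃CoPH F 2), ((θ.ZhUnity F 2 ∧ θ.SlotsNondegenerate₁₃ F 2) ∧ LiveSel F θ) → θ.Admissible F 2 →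
        ∀ (g₀ : ℕ → ℝ) (os : List (ULoop F)),
          ∃ W : ℕ → ℝ, RelWeightBound 1 (classSet₁₃ θ 0 g₀)
            (gapWeight2A₁₃ θ hP 0 g₀ os (ρ F θ hP g₀ os) (ρ' F θ hP g₀ os) (n₁ F θ hP g₀ os) (n₂ F θ hP g₀ os))
            (gapWeight2B₁₃ θ hP 0 g₀ os (ρ F θ hP g₀ os) (ρ' F θ hP g₀ os) (n₁ F θ hP g₀ os) (n₂ F θ hP g₀ os)) (badClass₁₃ θ 0 g₀ (jc F θ hP g₀ os)) W) ∧
      (∀ (F : T4Family) (θ : Stage13HParams F 2) (h : θ.Provisos₁₃SepCoPH F 2) (v : Revision₁₃ F 2 θ h),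
        ((θ.ZhUnity F 2 ∧ θ.SlotsNondegenerate₁₃ F 2) ∧ LiveSel F θ) → θ.Admissible F 2 →
        B16.EndStatementBPrinted (datumOfRecord₁₃SepCoPHV F 2 θ h v).C → DagBinding.EndpointExistence (datumOfRecord₁₃SepCoPHV F 2 θ h v).C.toB12 →
          ForSmallCouplings (datumOfRecord₁₃SepCoPHV F 2 θ h v) fun g₀ => ∀ os : List (ULoop F),
            PHolderD4 β (datumOfRecord₁₃SepCoPHV F 2 θ h v) (rrOfRecord 𝔯 ksel F θ h.toCore g₀ os) →
              letI : DecidableEq (Σ K, SiteSeqKey F (0 + K)) := Classical.decEq _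
              ∃ δ : ℕ → ℝ, NE7.Core 1 (F.side ^ 4) (classSet₁₃ θ 0 g₀) (badClass₁₃ θ 0 g₀ (jc F θ h.toCore g₀ os))
                (gapCore2A₁₃ θ h.toCore 0 g₀ os (ρ F θ h.toCore g₀ os) (ρ' F θ h.toCore g₀ os) (n₁ F θ h.toCore g₀ os) (n₂ F θ h.toCore g₀ os))
                (gapCore2B₁₃ θ h.toCore 0 g₀ os (ρ F θ h.toCore g₀ os) (ρ' F θ h.toCore g₀ os) (n₁ F θ h.toCore g₀ os) (n₂ F θ h.toCore g₀ os)) δ ∧ Summable δ) ∧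
      (∀ (F : T4Family) (θ : Stage13HParams F 2) (hP : θ.Provisos₁₃CoPH F 2), ((θ.ZhUnity F 2 ∧ θ.SlotsNondegenerate₁₃ F 2) ∧ ¬ LiveSel F θ) → θ.Admissible F 2 →
        ∀ (g₀ : ℕ → ℝ) (os : List (ULoop F)), PHolderD4 β (datumOfRecord₁₃CoPH F 2 θ hP) (rrOfRecord 𝔯 ksel F θ hP g₀ os) →
          ∃ δ : ℕ → ℝ, NE7.Target ((F.side : ℝ) ^ 4) 1 δ (fun K => T4GenFunBounds.schemeZ ((datumOfRecord₁₃CoPH F 2 θ hP).scheme g₀) os (0 + K)))) :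
    Summit.QuantumFields.YangMills.Theses.BalabanUVNodes.SpineGivenEndpointR13SepCoPHV :=
  spineGivenEndpointR13SepCoPHV_of_stubTextsV7 h₁ (stub2TextV7_of_rows_zeta hrows)

end Summit.QuantumFields.YangMills.Theorems.N21GappedRoadK3V7Knit

end
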